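import Summits.BirchSwinnertonDyer.Rank1Residual.GaloisImage.WildThreeCubeRootTower
import HarnessLib

/-!
# The cube-root rows of the EXOTIC core, read off the census residue `c₆/3^{v₃ c₆} ≡ ±2 (mod 9)`
# (cell `b2b-bsdres`, team n1011, seat p02 gen 4 — row T-b11 ARM A 'm = 3 structure', file F3d)

HONEST FRAMING (cell `b2b-bsdres`, run/shared/lean/b2b/bsd-rank1-residual/, verbatim in every
file): the goal of the cell is to DELETE the COMBINATION-SHAPED residual classes of the
Birch–Swinnerton-Dyer formula for ALL analytic-rank `≤ 1` elliptic curves over `ℚ` — "full BSD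
formula for every rank `≤ 1` curve in class `C`" assembled STRICTLY from published theorems — so
that the rank-`≤ 1` remainder becomes exactly the CONSTRUCTION-SHAPED classes, which are TYPED
(missing-input `Prop`s), NOT attempted. This is not "finishing BSD". Team n1011 (N10 / N11):
research route; no claim beyond the stated classes; labels UNCHANGED; nothing is booked. Theorems
only (no definition, no named fact).

## What this file proves

F3c (`WildThreeCubeRootTower`) proves the `3`-adic tower on the rows `v₃(c₄) = n₄`, `v₃(c₆) = n₆`,
`v₃(Δ) = n_Δ`, `2n₆ = n_Δ + 3` (`v₃(j − 1728) = 3`), `3n₄ ≥ n_Δ + 6` (`v₃ j ≥ 6`), `3 ∣ n₆`, under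
the hypothesis `∃ c ∈ ℚ, c³Δ/(2c₆) − 1 = 0 ∨ v₃(c³Δ/(2c₆) − 1) ≥ 2`.  This file discharges that
hypothesis from the CENSUS DIGIT the numerics actually record
(`HOME/b2b-bsdres-n1011-p02/m3/M3-LOCAL-NOTE.md` §6): with `u := c₆/3^{n₆}` (a `3`-adic unit),

* `exists_cubeRoot_witness_of_c₆_residue` — if `u ≡ 2s (mod 9)` for a sign `s = ±1`, in the form
  `u − 2s = 0 ∨ v₃(u − 2s) ≥ 2`, then `c := −4s·3^{1 − n₆/3}` is a witness: indeed, by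
  `1728Δ = c₄³ − c₆²`, `c³Δ/(2c₆) − 1 = (s/2)·((u − 2s) − c₄³/(3^{n₆}c₆))` and
  `v₃(c₄³/(3^{n₆}c₆)) = 3n₄ − 2n₆ ≥ 3`;
* `towerSurj_three_of_surj_of_c₆_residue`, `imageContainsSL2_three_of_surj_of_c₆_residue` — F3c's
  tower / Kato (12.5.2) corollaries with the cube-root hypothesis replaced by the residue condition.

* `c₆_residue_of_int` — the residue hypothesis from `c₆ = c₆'·3^{n₆}`, `9 ∣ c₆' − 2s` (integers);
* `isElliptic_5400bu1`, `towerSurj_three_5400bu1` — ONE per-curve instance as a template (Cremona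
  5400bu1, `y² = x³ + 1125x − 6250`, `(n₄, n₆, n_Δ) = (3,3,3)`, `s = 1`): every hypothesis except
  `surj(3)` is discharged by `norm_num` / `decide`; no `def`, no instance declaration (the curve is the
  literal `⟨0, 0, 0, 1125, -6250⟩`).

So the 154 census cells 'f₃ = 3 ∧ v₃ j ≥ 6 ∧ c₆′ ≡ ±2' of the note are theorem rows whose
hypotheses are all decided by integer arithmetic on `(c₄, c₆, Δ)` of the Cremona model, modulo the
census bit `surj(3)`.  Pure `ℚ` arithmetic; nothing booked; no label change.

References: [Serre1972] §5.3; [SerreAbelianLadic1968] IV-23 Lemma 3; [Kato2004Asterisque] (12.5.2).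
-/

noncomputable section

open scoped Classical

open WeierstrassCurve

namespace Summit.BirchSwinnertonDyer.Rank1Residual.GaloisImage

open Literature.NumberTheory.EllipticCurves Literature.NumberTheory.GaloisRepresentations

variable (W : WeierstrassCurve ℚ)

/-- **Cube-root witness from the residue.**  If `v₃(c₄) = n₄`, `v₃(c₆) = n₆`, `2n₆ = n_Δ + 3`,
`3n₄ ≥ n_Δ + 6`, `3 ∣ n₆` and `c₆/3^{n₆} ≡ 2s (mod 9)` (`s = ±1`), then `c = −4s·3/3^{n₆/3}`
satisfies `c³Δ/(2c₆) − 1 = 0 ∨ v₃(c³Δ/(2c₆) − 1) ≥ 2`: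
`c³Δ/(2c₆) − 1 = (s/2)((c₆/3^{n₆} − 2s) − c₄³/(3^{n₆} c₆))` by `1728Δ = c₄³ − c₆²`, and
`v₃(c₄³/(3^{n₆}c₆)) = 3n₄ − 2n₆ ≥ 3`. [this work] -/
theorem exists_cubeRoot_witness_of_c₆_residue {n₄ n₆ nΔ : ℕ} (hc₄ : padicValRat 3 W.c₄ = n₄)
    (hc₆ : padicValRat 3 W.c₆ = n₆) (hm : 2 * n₆ = nΔ + 3) (hj : nΔ + 6 ≤ 3 * n₄) (h3 : 3 ∣ n₆)
    {s : ℤ} (hs : s = 1 ∨ s = -1)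
    (hu : W.c₆ / 3 ^ n₆ - 2 * s = 0 ∨ (2 : ℤ) ≤ padicValRat 3 (W.c₆ / 3 ^ n₆ - 2 * s)) :
    ∃ c : ℚ, c ^ 3 * W.Δ / (2 * W.c₆) - 1 = 0 ∨
      (2 : ℤ) ≤ padicValRat 3 (c ^ 3 * W.Δ / (2 * W.c₆) - 1) := by
  haveI : Fact (Nat.Prime 3) := ⟨Nat.prime_three⟩
  obtain ⟨k, hk⟩ := h3
  have hc₆0 : W.c₆ ≠ 0 := by
    intro h0; rw [h0, padicValRat.zero] at hc₆; omega
  have hc₄0 : W.c₄ ≠ 0 := by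
    intro h0; rw [h0, padicValRat.zero] at hc₄; omega
  have h3k0 : (3 : ℚ) ^ k ≠ 0 := pow_ne_zero _ three_ne_zero
  have h3n0 : (3 : ℚ) ^ n₆ ≠ 0 := pow_ne_zero _ three_ne_zero
  have hs0 : (s : ℚ) ≠ 0 := by rcases hs with rfl | rfl <;> norm_num
  have hs2 : (s : ℚ) ^ 2 = 1 := by rcases hs with rfl | rfl <;> norm_num
  -- the Weierstrass relation `1728 Δ = c₄³ − c₆²`
  have hΔ' : W.Δ = (W.c₄ ^ 3 - W.c₆ ^ 2) / 1728 := by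
    have h := W.c_relation
    field_simp
    linarith
  set A : ℚ := W.c₆ / 3 ^ n₆ - 2 * s with hA
  set B : ℚ := -(W.c₄ ^ 3 / (3 ^ n₆ * W.c₆)) with hB
  refine ⟨-4 * s * 3 / 3 ^ k, ?_⟩
  -- the key identity
  have hpow : (3 : ℚ) ^ n₆ = ((3 : ℚ) ^ k) ^ 3 := by rw [hk, mul_comm, pow_mul]
  have key : (-4 * (s : ℚ) * 3 / 3 ^ k) ^ 3 * W.Δ / (2 * W.c₆) - 1 = (s : ℚ) / 2 * (A + B) := by
    rw [hA, hB, hΔ', hpow]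
    rcases hs with rfl | rfl <;>
    · push_cast
      field_simp
      ring
  rw [key]
  by_cases hD : A + B = 0
  · left; rw [hD, mul_zero]
  right
  -- valuations of the pieces
  have h3v : padicValRat 3 (3 : ℚ) = 1 := by exact_mod_cast padicValRat.self (p := 3) (by norm_num)
  have h2v : padicValRat 3 (2 : ℚ) = 0 := by
    rw [show (2 : ℚ) = ((2 : ℕ) : ℚ) by norm_num, padicValRat.of_nat]
    exact_mod_cast padicValNat.eq_zero_of_not_dvd (by norm_num : ¬ 3 ∣ 2)
  have hsv : padicValRat 3 (s : ℚ) = 0 := by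
    rcases hs with rfl | rfl
    · push_cast; exact padicValRat.one
    · push_cast; rw [padicValRat.neg]; exact padicValRat.one
  have hBv : padicValRat 3 B = 3 * (n₄ : ℤ) - ((n₆ : ℤ) + n₆) := by
    rw [hB, padicValRat.neg, padicValRat.div (pow_ne_zero 3 hc₄0) (mul_ne_zero h3n0 hc₆0),
      padicValRat.pow, padicValRat.mul h3n0 hc₆0, padicValRat.pow, hc₄, hc₆, h3v, mul_one]
    push_cast
    ring
  have hBge : (2 : ℤ) ≤ padicValRat 3 B := by rw [hBv]; omega
  have hDv : (2 : ℤ) ≤ padicValRat 3 (A + B) := by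
    rcases hu with hA0 | hA2
    · rw [hA0, zero_add]; exact hBge
    · exact (le_min hA2 hBge).trans (padicValRat.min_le_padicValRat_add hD)
  have hs2ne : (s : ℚ) / 2 ≠ 0 := div_ne_zero hs0 two_ne_zero
  rw [padicValRat.mul hs2ne hD, padicValRat.div hs0 two_ne_zero, hsv, h2v]
  simpa using hDv

/-- **Integer form of the residue hypothesis.**  If `c₆ = c₆' · 3^{n₆}` with `c₆' ∈ ℤ` and
`9 ∣ c₆' − 2s`, then `c₆/3^{n₆} − 2s = 0 ∨ v₃(c₆/3^{n₆} − 2s) ≥ 2` — the form consumed above; on a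
Cremona model this is decided by `decide`/`norm_num` on integers. [this work] -/
theorem c₆_residue_of_int {n₆ : ℕ} {c₆' s : ℤ} (hc₆' : W.c₆ = c₆' * 3 ^ n₆)
    (hu : (9 : ℤ) ∣ c₆' - 2 * s) :
    W.c₆ / 3 ^ n₆ - 2 * s = 0 ∨ (2 : ℤ) ≤ padicValRat 3 (W.c₆ / 3 ^ n₆ - 2 * s) := by
  haveI : Fact (Nat.Prime 3) := ⟨Nat.prime_three⟩
  have h3n0 : (3 : ℚ) ^ n₆ ≠ 0 := pow_ne_zero _ three_ne_zero
  have hq : W.c₆ / 3 ^ n₆ - 2 * s = ((c₆' - 2 * s : ℤ) : ℚ) := by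
    rw [hc₆']; push_cast; field_simp
  by_cases h0 : c₆' - 2 * s = 0
  · left; rw [hq, h0]; push_cast; ring
  right
  rw [hq, padicValRat.of_int]
  have h9 : (3 : ℤ) ^ 2 ∣ c₆' - 2 * s := by norm_num; exact hu
  exact_mod_cast ((padicValInt_dvd_iff 2 (c₆' - 2 * s)).mp h9).resolve_left h0

variable [W.IsElliptic]

/-- **The `3`-adic tower on the residue rows `c₆/3^{v₃ c₆} ≡ ±2 (mod 9)` of the EXOTIC core**
(`v₃(j − 1728) = 3`, `v₃ j ≥ 6`, `3 ∣ v₃ c₆`): `ρ̄_{E,3}` onto ⟹ `ρ̄_{E,3ⁿ}` onto for every `n`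
(F3c `towerSurj_three_of_surj_of_cubeRoot` + `exists_cubeRoot_witness_of_c₆_residue`).
[cite: SerreAbelianLadic1968, Ch. IV §3.4, Lemma 3 (IV-23)] [cite: Serre1972, §5.3] -/
theorem towerSurj_three_of_surj_of_c₆_residue (hsurj : W.HasSurjectiveModNGaloisRep 3)
    {n₄ n₆ nΔ : ℕ} (hc₄ : padicValRat 3 W.c₄ = n₄) (hc₆ : padicValRat 3 W.c₆ = n₆)
    (hΔ : padicValRat 3 W.Δ = nΔ) (hm : 2 * n₆ = nΔ + 3) (hj : nΔ + 6 ≤ 3 * n₄) (h3 : 3 ∣ n₆)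
    {s : ℤ} (hs : s = 1 ∨ s = -1)
    (hu : W.c₆ / 3 ^ n₆ - 2 * s = 0 ∨ (2 : ℤ) ≤ padicValRat 3 (W.c₆ / 3 ^ n₆ - 2 * s)) (n : ℕ) :
    W.HasSurjectiveModNGaloisRep (3 ^ n : ℕ) :=
  towerSurj_three_of_surj_of_cubeRoot W hsurj hc₄ hc₆ hΔ hm hj h3
    (exists_cubeRoot_witness_of_c₆_residue W hc₄ hc₆ hm hj h3 hs hu) n

/-- **Kato's (12.5.2) at `3` on the residue rows `c₆/3^{v₃ c₆} ≡ ±2 (mod 9)` of the EXOTIC core**: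
the image of `Gal(ℚ̄/ℚ(ζ_{3^∞}))` in `Aut(T₃E)` contains `SL₂(ℤ₃)`.
[cite: Kato2004Asterisque, (12.5.2) (p. 222)] [cite: SerreAbelianLadic1968, Ch. IV §3.4, Lemma 3 (IV-23)] -/
theorem imageContainsSL2_three_of_surj_of_c₆_residue (hsurj : W.HasSurjectiveModNGaloisRep 3)
    {n₄ n₆ nΔ : ℕ} (hc₄ : padicValRat 3 W.c₄ = n₄) (hc₆ : padicValRat 3 W.c₆ = n₆)
    (hΔ : padicValRat 3 W.Δ = nΔ) (hm : 2 * n₆ = nΔ + 3) (hj : nΔ + 6 ≤ 3 * n₄) (h3 : 3 ∣ n₆)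
    {s : ℤ} (hs : s = 1 ∨ s = -1)
    (hu : W.c₆ / 3 ^ n₆ - 2 * s = 0 ∨ (2 : ℤ) ≤ padicValRat 3 (W.c₆ / 3 ^ n₆ - 2 * s)) :
    Kato2004.ImageContainsSL2 W 3 :=
  imageContainsSL2_three_of_surj_of_cubeRoot W hsurj hc₄ hc₆ hΔ hm hj h3
    (exists_cubeRoot_witness_of_c₆_residue W hc₄ hc₆ hm hj h3 hs hu)

/-! ### A per-curve instance (template for the census consumers): Cremona 5400bu1
`y² = x³ + 1125x − 6250`: `c₄ = −54000 = −2000·3³`, `c₆ = 5400000 = 200000·3³`,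
`Δ = −108000000000 = −4000000000·3³`; `(n₄, n₆, n_Δ) = (3, 3, 3)`, `s = 1`, `9 ∣ 200000 − 2`. -/

/-- `v₃(3³·z) = 3` for an integer `z` prime to `3` (bookkeeping for the instance below). [folklore] -/
private theorem padicValRat_three_cube_mul {q : ℚ} {z : ℤ} (hq : q = (3 : ℚ) ^ 3 * z)
    (hz : ¬ (3 : ℤ) ∣ z) : padicValRat 3 q = ((3 : ℕ) : ℤ) := by
  haveI : Fact (Nat.Prime 3) := ⟨Nat.prime_three⟩
  have hz0 : (z : ℚ) ≠ 0 := by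
    intro h; apply hz; have : z = 0 := by exact_mod_cast h
    rw [this]; exact dvd_zero 3
  rw [hq, padicValRat.mul (pow_ne_zero _ three_ne_zero) hz0, padicValRat.pow,
    show padicValRat 3 (3 : ℚ) = 1 by exact_mod_cast padicValRat.self (p := 3) (by norm_num),
    padicValRat.of_int, padicValInt.eq_zero_of_not_dvd hz]
  norm_num

/-- Cremona **5400bu1** `y² = x³ + 1125x − 6250` is an elliptic curve (`Δ = −108000000000 ≠ 0`). -/
theorem isElliptic_5400bu1 : (⟨0, 0, 0, 1125, -6250⟩ : WeierstrassCurve ℚ).IsElliptic :=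
  ⟨by
    rw [isUnit_iff_ne_zero]
    norm_num [WeierstrassCurve.Δ, WeierstrassCurve.b₂, WeierstrassCurve.b₄, WeierstrassCurve.b₆,
      WeierstrassCurve.b₈]⟩

/-- **The `3`-adic tower for Cremona 5400bu1, given `ρ̄_{E,3}` onto** (the census bit; Serre's
criterion is not re-proved here): the instance `(n₄, n₆, n_Δ) = (3, 3, 3)`, `s = 1`,
`c₆ = 200000 · 3³`, `9 ∣ 200000 − 2` of `towerSurj_three_of_surj_of_c₆_residue` — every
hypothesis except `surj(3)` discharged by `norm_num` / `decide` on integers. [this work] -/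
theorem towerSurj_three_5400bu1
    (hsurj : haveI := isElliptic_5400bu1
      (⟨0, 0, 0, 1125, -6250⟩ : WeierstrassCurve ℚ).HasSurjectiveModNGaloisRep 3) (n : ℕ) :
    haveI := isElliptic_5400bu1
    (⟨0, 0, 0, 1125, -6250⟩ : WeierstrassCurve ℚ).HasSurjectiveModNGaloisRep (3 ^ n : ℕ) := by
  haveI := isElliptic_5400bu1
  have hc₄ : (⟨0, 0, 0, 1125, -6250⟩ : WeierstrassCurve ℚ).c₄ = (3 : ℚ) ^ 3 * (-2000 : ℤ) := by
    norm_num [WeierstrassCurve.c₄, WeierstrassCurve.b₂, WeierstrassCurve.b₄]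
  have hc₆ : (⟨0, 0, 0, 1125, -6250⟩ : WeierstrassCurve ℚ).c₆ = (3 : ℚ) ^ 3 * (200000 : ℤ) := by
    norm_num [WeierstrassCurve.c₆, WeierstrassCurve.b₂, WeierstrassCurve.b₄, WeierstrassCurve.b₆]
  have hΔ : (⟨0, 0, 0, 1125, -6250⟩ : WeierstrassCurve ℚ).Δ = (3 : ℚ) ^ 3 * (-4000000000 : ℤ) := by
    norm_num [WeierstrassCurve.Δ, WeierstrassCurve.b₂, WeierstrassCurve.b₄, WeierstrassCurve.b₆,
      WeierstrassCurve.b₈]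
  have hc₆' : (⟨0, 0, 0, 1125, -6250⟩ : WeierstrassCurve ℚ).c₆ = (200000 : ℤ) * 3 ^ (3 : ℕ) := by
    rw [hc₆]; push_cast; ring
  exact towerSurj_three_of_surj_of_c₆_residue _ hsurj (n₄ := 3) (n₆ := 3) (nΔ := 3)
    (padicValRat_three_cube_mul hc₄ (by decide)) (padicValRat_three_cube_mul hc₆ (by decide))
    (padicValRat_three_cube_mul hΔ (by decide)) (by norm_num) (by norm_num) (dvd_refl 3)
    (s := 1) (Or.inl rfl) (c₆_residue_of_int _ hc₆' (by decide)) n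

end Summit.BirchSwinnertonDyer.Rank1Residual.GaloisImage

end
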